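import Summits.MatrixMultiplication.MatrixMultiplication.Theses.EisensteinValCertificates
import Summits.MatrixMultiplication.MatrixMultiplication.Theses.GroupTheoreticSTPP
import Summits.MatrixMultiplication.MatrixMultiplication.Theses.AutomaticSTPPDesigns
import Summits.MatrixMultiplication.MatrixMultiplication.Theorems.AutomaticSTPPDesignsAutomaticPackingThesisRankNormalForm
import Summits.MatrixMultiplication.MatrixMultiplication.Theorems.AutomaticSTPPDesignsAutomaticPackingThesisPrimeUniform
import Summits.MatrixMultiplication.MatrixMultiplication.Theorems.AutomaticSTPPDesignsAutomaticPackingThesisCruxGivesCThesis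
import Summits.MatrixMultiplication.MatrixMultiplication.Theorems.EisensteinValCertificatesHomocyclicSTPPDesignsOfPrimeTwoFamilies
import Summits.MatrixMultiplication.MatrixMultiplication.Theorems.EisensteinValCertificatesHomocyclicSTPPDesignsLargeBlockTools
import Literature.Computability.AlgebraicComplexity.PrattPackingTransferThm44Proofs
import Literature.Barriers.MatrixMultiplication.TricoloredSumFreeBarrierProofs

set_option linter.dupNamespace false
-- (single-conjunct summit: the namespace repeats `MatrixMultiplication`)

/-!
# Prime-cyclic universality for `HomocyclicSTPPDesigns` (crux stmt-MatrixMultiplication-10647), part 1: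
# `X′ ↔ AutomaticPackingThesis` and the kill sides unify

Route `EisensteinValCertificates`, crux `HomocyclicSTPPDesigns` = X′ (for every `ε > 0` an STPP family in
some `(ℤ/q)^ℓ`, `q` a prime power, with `Σ (|A||B||C|)^{(2+ε)/3} > q^ℓ`).  This file LANDS the
kernel-checked objects of the crux strategist's gen-2 census (`Cruxes/HomocyclicSTPPDesigns/SketchStrategist2.lean`,
planner-cstrat-stmt-MatrixMultiplication-10647-s1-0, 2026-08-17; §1–§3 verbatim), registered as
calibration stubs of the crux and landed by the line lead (c5):

* `homocyclicSTPPDesigns_iff_automaticPackingThesis` (registered stub) — **U1: the homocyclic hosts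
  `(ℤ/q)^ℓ` buy nothing over prime cyclic hosts**: X′ `↔` `AutomaticSTPPDesigns.AutomaticPackingThesis`
  (crux stmt-MatrixMultiplication-7356 of route AutomaticSTPPDesigns).  MECHANISM: an X′-witness at `ε/67`
  in `K = (ℤ/q)^ℓ` has `Σ (abc)^{2/3} ≤ (q e^{-δ})^ℓ` (BCCGNSU 2017 Thm A′ + §3.2, tree
  `AddSimultaneousTPP.sum_rpow_two_thirds_le_pow`, `δ = log((2/3)2^{2/3})`); Hölder in the exponent
  (`(2+ε/67)/3 = (66/67)(2/3) + (1/67)(2+ε)/3`, `margin_of_twoThirds_bound`) gives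
  `Σ v^{(2+ε)/3} > q^ℓ e^{66δℓ} > 9^ℓ q^ℓ` (`nine_pow_mul_lt_sum_of_witness`) — a margin that feeds the
  sibling's landed rank normal form `automaticPackingThesis_iff_rankBeat` (beat `3^R N^R` in `(ℤ/N)^R`);
  conversely a prime cyclic host `ℤ/q` is `(ℤ/q)^1` (`automaticPackingThesis_iff_primeUniformBeat`).
  This is the design-level reading of the Hölder step in the proof of Pratt 2024 Thm 4.4
  (arXiv:2309.03878, p. 9), stopped at exponent `(2+ε)/3` instead of at the mass.
* `noHomocyclicSTPP_iff_uniformCyclicGap` (registered stub) — **kill sides unify**: the route's negative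
  milestone `NoHomocyclicSTPP` (stmt-7787, `= ¬X′`) is the uniform cyclic packing ceiling
  `∃ τ₀ > 2/3 ∀ N ≥ 2 ∀ STPP in ℤ/N, Σ (abc)^τ₀ ≤ N` (`not_automaticPackingThesis_iff_uniformGap`).

Part 2 (`…UniversalityGlue.lean`) lands the U2 glue `CThesis → X′` modulo two typed lemmas.

Sources: Blasiak–Church–Cohn–Grochow–Naslund–Sawin–Umans 2017 (Discrete Analysis), Thm A′ and §3.2;
K. Pratt, *On generalized corners and matrix multiplication*, ITCS 2024 = arXiv:2309.03878, proofs of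
Thm 4.4 and Thm 4.7; Cohn–Kleinberg–Szegedy–Umans 2005 (the STPP).
-/

namespace Summit.MatrixMultiplication.MatrixMultiplication.Theorems.HomocyclicSTPPDesigns.Universality

open Summit.MatrixMultiplication.MatrixMultiplication.Theses.EisensteinValCertificates
  (HomocyclicSTPPDesigns NoHomocyclicSTPP)
open Summit.MatrixMultiplication.MatrixMultiplication.Theses.GroupTheoreticSTPP
  (CThesis CAbelianObstructionNeg)
open Summit.MatrixMultiplication.MatrixMultiplication.Theses.AutomaticSTPPDesigns (AutomaticPackingThesis)
open Summit.MatrixMultiplication.MatrixMultiplication.Theorems.AutomaticPackingThesis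
  (automaticPackingThesis_iff_rankBeat automaticPackingThesis_iff_primeUniformBeat
   not_automaticPackingThesis_iff_uniformGap cThesis_of_automaticPackingThesis)
open Summit.MatrixMultiplication.MatrixMultiplication.Theorems.HomocyclicSTPPDesigns.LargeBlock
  (exists_prime_isSTPP_of_addEquiv)
open Literature.Computability.AlgebraicComplexity Literature.Combinatorics.Additive
  Literature.Barriers.MatrixMultiplication Finset
open scoped BigOperators

/-! ## §1 The Hölder margin lemma -/

/-- Hölder in the exponent: for nonnegative reals, `0 < α < 1` and any `τ`,
`Σ aᵢ^{(2/3)α + τ(1−α)} ≤ (Σ aᵢ^{2/3})^α (Σ aᵢ^τ)^{1−α}`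
(tree template `sum_rpow_le_rpow_mul_rpow_holder`, which is the case `τ = 1`). [folklore] -/
theorem sum_rpow_le_holder {ι : Type*} (s : Finset ι) (a : ι → ℝ) (ha : ∀ i, 0 ≤ a i)
    {α : ℝ} (hα0 : 0 < α) (hα1 : α < 1) {τ : ℝ} (hτ : 0 ≤ τ) :
    ∑ i ∈ s, a i ^ (2 / 3 * α + τ * (1 - α)) ≤
      (∑ i ∈ s, a i ^ ((2 : ℝ) / 3)) ^ α * (∑ i ∈ s, a i ^ τ) ^ (1 - α) := by
  have hpq := Real.HolderConjugate.inv_one_sub_inv hα0 hα1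
  have h := Real.inner_le_Lp_mul_Lq_of_nonneg s (f := fun i => a i ^ (2 / 3 * α))
    (g := fun i => a i ^ (τ * (1 - α))) hpq (fun i _ => Real.rpow_nonneg (ha i) _)
    (fun i _ => Real.rpow_nonneg (ha i) _)
  have hpos : 0 < 2 / 3 * α + τ * (1 - α) := by
    have h1 : 0 ≤ τ * (1 - α) := mul_nonneg hτ (by linarith)
    linarith
  have e1 : ∀ i ∈ s, a i ^ (2 / 3 * α + τ * (1 - α)) = a i ^ (2 / 3 * α) * a i ^ (τ * (1 - α)) :=
    fun i _ => Real.rpow_add' (ha i) hpos.ne'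
  have e2 : ∀ i ∈ s, (a i ^ (2 / 3 * α)) ^ α⁻¹ = a i ^ ((2 : ℝ) / 3) := by
    intro i _
    rw [← Real.rpow_mul (ha i)]
    congr 1
    field_simp
  have e3 : ∀ i ∈ s, (a i ^ (τ * (1 - α))) ^ (1 - α)⁻¹ = a i ^ τ := by
    intro i _
    rw [← Real.rpow_mul (ha i), mul_inv_cancel_right₀ (sub_ne_zero.2 hα1.ne')]
  rw [Finset.sum_congr rfl e1]
  refine h.trans (le_of_eq ?_)
  rw [Finset.sum_congr rfl e2, Finset.sum_congr rfl e3, one_div, inv_inv, one_div, inv_inv]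

/-- **The margin lemma** at `α = 66/67`: if `Σ aᵢ^{2/3} ≤ Y` and `Q < Σ aᵢ^{(2+ε/67)/3}` then
`Q^{67} < Y^{66} · Σ aᵢ^{(2+ε)/3}` (cleared of fractional powers; `(2+ε/67)/3 = (66/67)(2/3) +
(1/67)(2+ε)/3`). [folklore] -/
theorem margin_of_twoThirds_bound {ι : Type*} (s : Finset ι) (a : ι → ℝ) (ha : ∀ i, 0 ≤ a i)
    {Q Y ε : ℝ} (hQ : 0 ≤ Q) (hε : 0 ≤ ε) (hF : ∑ i ∈ s, a i ^ ((2 : ℝ) / 3) ≤ Y)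
    (hlt : Q < ∑ i ∈ s, a i ^ ((2 + ε / 67) / 3)) :
    Q ^ 67 < Y ^ 66 * ∑ i ∈ s, a i ^ ((2 + ε) / 3) := by
  have h := sum_rpow_le_holder s a ha (α := 66 / 67) (by norm_num) (by norm_num)
    (τ := (2 + ε) / 3) (by positivity)
  have hexp : (2 / 3 * (66 / 67 : ℝ) + (2 + ε) / 3 * (1 - 66 / 67)) = (2 + ε / 67) / 3 := by ring
  rw [hexp] at h
  have hF0 : 0 ≤ ∑ i ∈ s, a i ^ ((2 : ℝ) / 3) :=
    Finset.sum_nonneg fun i _ => Real.rpow_nonneg (ha i) _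
  have hT0 : 0 ≤ ∑ i ∈ s, a i ^ ((2 + ε) / 3) :=
    Finset.sum_nonneg fun i _ => Real.rpow_nonneg (ha i) _
  have hs0 : 0 ≤ ∑ i ∈ s, a i ^ ((2 + ε / 67) / 3) :=
    Finset.sum_nonneg fun i _ => Real.rpow_nonneg (ha i) _
  have hY0 : 0 ≤ Y := hF0.trans hF
  calc Q ^ 67 < (∑ i ∈ s, a i ^ ((2 + ε / 67) / 3)) ^ 67 := pow_lt_pow_left₀ hlt hQ (by norm_num)
    _ ≤ ((∑ i ∈ s, a i ^ ((2 : ℝ) / 3)) ^ ((66 : ℝ) / 67) *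
          (∑ i ∈ s, a i ^ ((2 + ε) / 3)) ^ (1 - (66 : ℝ) / 67)) ^ 67 :=
        pow_le_pow_left₀ hs0 h 67
    _ = (∑ i ∈ s, a i ^ ((2 : ℝ) / 3)) ^ 66 * ∑ i ∈ s, a i ^ ((2 + ε) / 3) := by
        rw [mul_pow, ← Real.rpow_mul_natCast hF0, ← Real.rpow_mul_natCast hT0]
        norm_num
    _ ≤ Y ^ 66 * ∑ i ∈ s, a i ^ ((2 + ε) / 3) :=
        mul_le_mul_of_nonneg_right (pow_le_pow_left₀ hF0 hF 66) hT0

/-- `e^{66δ} > 9` (square of the tree's `e^{33δ} > 3`). [folklore] -/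
theorem nine_lt_exp_66_delta : (9 : ℝ) < Real.exp (66 * bccgnsuDelta) := by
  have h3 := three_lt_exp_mul_bccgnsuDelta
  have h : Real.exp (66 * bccgnsuDelta) = Real.exp (33 * bccgnsuDelta) ^ 2 := by
    rw [← Real.exp_nat_mul]; congr 1; push_cast; ring
  rw [h]
  nlinarith [Real.exp_pos (33 * bccgnsuDelta)]

/-! ## §2 A homocyclic witness at `ε/67` beats `9^ℓ q^ℓ` at `ε` -/

/-- **Forced margin.** An STPP family in `(ℤ/q)^ℓ` (`q` a prime power) with
`q^ℓ < Σ (abc)^{(2+ε/67)/3}` has `9^ℓ q^ℓ < Σ (abc)^{(2+ε)/3}`: the slice-rank `2/3`-moment bound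
`Σ (abc)^{2/3} ≤ (q e^{-δ})^ℓ` (tree, BCCGNSU Thm A′ + §3.2) and Hölder give
`Σ (abc)^{(2+ε)/3} > q^ℓ e^{66δℓ} > 9^ℓ q^ℓ`.
[cite: BlasiakChurchCohnGrochowNaslundSawinUmans2017, Thm. A′ and §3.2]
[cite: Pratt2024, Thm. 4.4 (proof)] -/
theorem nine_pow_mul_lt_sum_of_witness {q ℓ : ℕ} (hq : IsPrimePow q) {N : ℕ}
    {A B C : Fin N → Finset (Fin ℓ → ZMod q)} (hS : IsSTPP A B C) {ε : ℝ} (hε : 0 ≤ ε)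
    (hlt : (q : ℝ) ^ ℓ <
      ∑ i, (((A i).card * (B i).card * (C i).card : ℕ) : ℝ) ^ ((2 + ε / 67) / 3)) :
    (9 : ℝ) ^ ℓ * (q : ℝ) ^ ℓ <
      ∑ i, (((A i).card * (B i).card * (C i).card : ℕ) : ℝ) ^ ((2 + ε) / 3) := by
  have hq0 : (0 : ℝ) < q := by exact_mod_cast hq.pos
  set a : Fin N → ℝ := fun i => (((A i).card * (B i).card * (C i).card : ℕ) : ℝ) with ha
  have ha0 : ∀ i, 0 ≤ a i := fun i => Nat.cast_nonneg _
  have hF := ((isSTPP_iff_addSimultaneousTPP A B C).1 hS).sum_rpow_two_thirds_le_pow hq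
  set Y : ℝ := ((q : ℝ) * Real.exp (-bccgnsuDelta)) ^ ℓ with hY
  have hYpos : 0 < Y := by positivity
  have hm := margin_of_twoThirds_bound Finset.univ a ha0 (pow_nonneg hq0.le ℓ) hε hF hlt
  set T : ℝ := ∑ i, a i ^ ((2 + ε) / 3) with hT
  -- `q^{67ℓ} = Y^{66} · (q e^{66δ})^ℓ`
  have key : ((q : ℝ) ^ ℓ) ^ 67 = Y ^ 66 * ((q : ℝ) * Real.exp (66 * bccgnsuDelta)) ^ ℓ := by
    have k1 : (q : ℝ) ^ 67 =
        ((q : ℝ) * Real.exp (-bccgnsuDelta)) ^ 66 * ((q : ℝ) * Real.exp (66 * bccgnsuDelta)) := by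
      rw [mul_pow, mul_mul_mul_comm, ← pow_succ, ← Real.exp_nat_mul, ← Real.exp_add]
      norm_num
    have eq1 : (((q : ℝ) * Real.exp (-bccgnsuDelta)) ^ ℓ) ^ 66 *
        ((q : ℝ) * Real.exp (66 * bccgnsuDelta)) ^ ℓ =
        (((q : ℝ) * Real.exp (-bccgnsuDelta)) ^ 66 * ((q : ℝ) * Real.exp (66 * bccgnsuDelta))) ^ ℓ := by
      rw [← pow_mul, mul_comm ℓ 66, pow_mul, ← mul_pow]
    rw [hY, eq1, ← k1, ← pow_mul, ← pow_mul, mul_comm ℓ 67]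
  rw [key] at hm
  have h3 : ((q : ℝ) * Real.exp (66 * bccgnsuDelta)) ^ ℓ < T :=
    lt_of_mul_lt_mul_left hm (pow_nonneg hYpos.le 66)
  have h4 : (9 : ℝ) ^ ℓ * (q : ℝ) ^ ℓ ≤ ((q : ℝ) * Real.exp (66 * bccgnsuDelta)) ^ ℓ := by
    rw [← mul_pow]
    refine pow_le_pow_left₀ (by positivity) ?_ ℓ
    rw [mul_comm]
    exact mul_le_mul_of_nonneg_left nine_lt_exp_66_delta.le hq0.le
  exact h4.trans_lt h3

/-- In a subsingleton group an STPP family has packing sum `≤ 1` at every exponent `τ > 0`: every set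
is `⊆ {0}`, and two distinct indices with all three sets nonempty violate the STPP. [folklore] -/
theorem sum_rpow_le_one_of_subsingleton {K : Type*} [AddCommGroup K] [Subsingleton K] {N : ℕ}
    {A B C : Fin N → Finset K} (hS : IsSTPP A B C) {τ : ℝ} (hτ : 0 < τ) :
    ∑ i, (((A i).card * (B i).card * (C i).card : ℕ) : ℝ) ^ τ ≤ 1 := by
  classical
  -- volumes are 0 or 1
  have hcard : ∀ (S : Finset K), S.card ≤ 1 := fun S =>
    Finset.card_le_one.2 fun x _ y _ => Subsingleton.elim x y
  have hvol : ∀ i, (A i).card * (B i).card * (C i).card ≤ 1 := fun i => by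
    calc (A i).card * (B i).card * (C i).card ≤ 1 * 1 * 1 := by
          gcongr <;> exact hcard _
      _ = 1 := by norm_num
  -- at most one index has volume 1
  have hne : ∀ i, (A i).card * (B i).card * (C i).card = 1 →
      (A i).Nonempty ∧ (B i).Nonempty ∧ (C i).Nonempty := by
    intro i hi
    have hC1 : (C i).card = 1 := Nat.eq_one_of_mul_eq_one_left hi
    have hAB : (A i).card * (B i).card = 1 := Nat.eq_one_of_mul_eq_one_right hi
    have hA1 : (A i).card = 1 := Nat.eq_one_of_mul_eq_one_right hAB
    have hB1 : (B i).card = 1 := Nat.eq_one_of_mul_eq_one_left hAB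
    exact ⟨Finset.card_pos.1 (by omega), Finset.card_pos.1 (by omega), Finset.card_pos.1 (by omega)⟩
  have huniq : ∀ i j, (A i).card * (B i).card * (C i).card = 1 →
      (A j).card * (B j).card * (C j).card = 1 → i = j := by
    intro i j hi hj
    obtain ⟨⟨s', hs'⟩, ⟨t, ht⟩, ⟨u, hu⟩⟩ := hne i hi
    obtain ⟨⟨s, hs⟩, -, ⟨u', hu'⟩⟩ := hne j hj
    -- instance (i, i, j) of the STPP: `s ∈ A j, s' ∈ A i, t t' ∈ B i, u ∈ C i, u' ∈ C j`
    have h := hS i i j s hs s' hs' t ht t ht u hu u' hu' (Subsingleton.elim _ _)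
    exact h.2.1
  -- sum over the (at most one) index of volume 1
  by_cases hex : ∃ i, (A i).card * (B i).card * (C i).card = 1
  · obtain ⟨i₀, hi₀⟩ := hex
    have hsum : ∑ i, (((A i).card * (B i).card * (C i).card : ℕ) : ℝ) ^ τ =
        (((A i₀).card * (B i₀).card * (C i₀).card : ℕ) : ℝ) ^ τ := by
      refine Finset.sum_eq_single i₀ (fun j _ hj => ?_) (fun h => absurd (Finset.mem_univ _) h)
      have hj0 : (A j).card * (B j).card * (C j).card = 0 := by
        rcases Nat.le_one_iff_eq_zero_or_eq_one.1 (hvol j) with h | h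
        · exact h
        · exact absurd (huniq j i₀ h hi₀) hj
      rw [hj0, Nat.cast_zero, Real.zero_rpow hτ.ne']
    rw [hsum, hi₀, Nat.cast_one, Real.one_rpow]
  · push Not at hex
    have hsum : ∑ i, (((A i).card * (B i).card * (C i).card : ℕ) : ℝ) ^ τ = 0 := by
      refine Finset.sum_eq_zero fun i _ => ?_
      have hi0 : (A i).card * (B i).card * (C i).card = 0 := by
        rcases Nat.le_one_iff_eq_zero_or_eq_one.1 (hvol i) with h | h
        · exact h
        · exact absurd h (hex i)
      rw [hi0, Nat.cast_zero, Real.zero_rpow hτ.ne']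
    rw [hsum]; exact zero_le_one

/-! ## §3 U1: `HomocyclicSTPPDesigns ↔ AutomaticPackingThesis` -/

/-- **X′ ⟹ X_aut.** Through the sibling's landed rank normal form
`automaticPackingThesis_iff_rankBeat` (X_aut ⟺ some STPP family in some `(ℤ/N)^R` beats `3^R N^R`):
an X′-witness at `ε/67` beats `9^ℓ q^ℓ ≥ 3^ℓ q^ℓ` at `ε` (`nine_pow_mul_lt_sum_of_witness`); `ℓ ≥ 1`
because nothing beats the trivial group. [cite: Pratt2024, Thm. 4.4 (proof) and Thm. 4.7 (proof)] -/
theorem automaticPackingThesis_of_homocyclicSTPPDesigns (h : HomocyclicSTPPDesigns) :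
    AutomaticPackingThesis := by
  rw [automaticPackingThesis_iff_rankBeat]
  intro τ hτ
  set ε : ℝ := 3 * τ - 2 with hε
  have hεpos : 0 < ε := by rw [hε]; linarith
  obtain ⟨q, ℓ, hq, N, A, B, C, hS, hlt⟩ := h (ε / 67) (by positivity)
  haveI : NeZero q := ⟨hq.ne_zero⟩
  have hq1 : 1 ≤ q := hq.one_lt.le
  -- `ℓ ≥ 1`: the trivial group hosts no witness
  have hℓ : 1 ≤ ℓ := by
    rcases Nat.eq_zero_or_pos ℓ with h0 | hpos
    · exfalso
      subst h0
      haveI : Subsingleton (Fin 0 → ZMod q) := inferInstance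
      have hle := sum_rpow_le_one_of_subsingleton hS (τ := (2 + ε / 67) / 3) (by positivity)
      rw [pow_zero] at hlt
      exact absurd (hlt.trans_le hle) (lt_irrefl _)
    · exact hpos
  refine ⟨q, ℓ, N, hq1, hℓ, A, B, C, hS, ?_⟩
  have hmain := nine_pow_mul_lt_sum_of_witness hq hS hεpos.le hlt
  have hτε : (2 + ε) / 3 = τ := by rw [hε]; ring
  rw [hτε] at hmain
  have hq0 : (0 : ℝ) ≤ (q : ℝ) ^ ℓ := by positivity
  calc (3 : ℝ) ^ ℓ * (q : ℝ) ^ ℓ ≤ (9 : ℝ) ^ ℓ * (q : ℝ) ^ ℓ := by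
        gcongr; norm_num
    _ < _ := hmain

/-- **X_aut ⟹ X′.** Through the sibling's landed prime-uniform normal form: a prime cyclic host
`ℤ/q` is the homocyclic host `(ℤ/q)^1` (embed along `x ↦ (fun _ => x)`). [folklore] -/
theorem homocyclicSTPPDesigns_of_automaticPackingThesis (h : AutomaticPackingThesis) :
    HomocyclicSTPPDesigns := by
  intro ε hε
  have hτ : (2 : ℝ) / 3 < (2 + ε) / 3 := by linarith
  obtain ⟨q, n, M, hq, hM, A, B, C, hS, hcard, hbeat⟩ :=
    (automaticPackingThesis_iff_primeUniformBeat.1 h) _ hτ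
  haveI : Fact q.Prime := ⟨hq⟩
  let ι₁ : ZMod q →+ (Fin 1 → ZMod q) :=
    { toFun := fun x _ => x, map_zero' := rfl, map_add' := fun _ _ => rfl }
  have hι₁inj : Function.Injective ι₁ := fun x y hxy => congrFun hxy 0
  have hS' := hS.image ι₁ hι₁inj
  refine ⟨q, 1, hq.isPrimePow, n, fun i => (A i).image ι₁, fun i => (B i).image ι₁,
    fun i => (C i).image ι₁, hS', ?_⟩
  have hsum : ∑ i, ((((A i).image ι₁).card * ((B i).image ι₁).card * ((C i).image ι₁).card : ℕ) : ℝ) ^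
      ((2 + ε) / 3) = ∑ _i : Fin n, (((M : ℝ) ^ 3)) ^ ((2 + ε) / 3) := by
    refine Finset.sum_congr rfl fun i _ => ?_
    rw [card_image_of_injective _ hι₁inj, card_image_of_injective _ hι₁inj,
      card_image_of_injective _ hι₁inj, (hcard i).1, (hcard i).2.1, (hcard i).2.2]
    push_cast
    ring_nf
  rw [hsum, Finset.sum_const, Finset.card_univ, Fintype.card_fin, nsmul_eq_mul, pow_one]
  exact hbeat

/-- **U1: the homocyclic apex and the cyclic-tower apex are ONE statement.**
`EisensteinValCertificates.HomocyclicSTPPDesigns` (stmt-10647) `↔`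
`AutomaticSTPPDesigns.AutomaticPackingThesis` (stmt-7356). -/
theorem homocyclicSTPPDesigns_iff_automaticPackingThesis :
    HomocyclicSTPPDesigns ↔
      Summit.MatrixMultiplication.MatrixMultiplication.Theses.AutomaticSTPPDesigns.AutomaticPackingThesis :=
  ⟨automaticPackingThesis_of_homocyclicSTPPDesigns, homocyclicSTPPDesigns_of_automaticPackingThesis⟩

/-- **Kill sides unify.** The route's negative milestone `NoHomocyclicSTPP` (stmt-7787, `= ¬X′`) is
EQUIVALENT to the uniform cyclic packing ceiling of route AutomaticSTPPDesigns
(`not_automaticPackingThesis_iff_uniformGap`): some `τ₀ > 2/3` with `Σ (abc)^τ₀ ≤ N` for every STPP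
family in every `ℤ/N`, `N ≥ 2`. [folklore] -/
theorem noHomocyclicSTPP_iff_uniformCyclicGap :
    NoHomocyclicSTPP ↔ ∃ τ₀ : ℝ, 2 / 3 < τ₀ ∧ ∀ (N n : ℕ), 2 ≤ N → ∀ (A B C : Fin n → Finset (ZMod N)),
      Literature.Computability.AlgebraicComplexity.IsSTPP A B C →
        ∑ i, (((A i).card * (B i).card * (C i).card : ℕ) : ℝ) ^ τ₀ ≤ (N : ℝ) := by
  rw [← not_automaticPackingThesis_iff_uniformGap, ← homocyclicSTPPDesigns_iff_automaticPackingThesis]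
  constructor
  · rintro ⟨ε, hε, hall⟩ hX
    obtain ⟨q, ℓ, hq, N, A, B, C, hS, hlt⟩ := hX ε hε
    exact absurd (hall q ℓ hq N A B C hS) (not_le.2 hlt)
  · intro hX
    by_contra hNo
    apply hX
    intro ε hε
    by_contra hex
    apply hNo
    refine ⟨ε, hε, fun q ℓ hq N A B C hS => ?_⟩
    by_contra hgt
    exact hex ⟨q, ℓ, hq, N, A, B, C, hS, not_le.1 hgt⟩

/-- The sandwich collapses on one side already: `X_aut → X_C` (sibling, landed) and `X′ → X_C`
(landed) are now the SAME arrow. Recorded for the census. -/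
example (h : HomocyclicSTPPDesigns) : CThesis :=
  cThesis_of_automaticPackingThesis (automaticPackingThesis_of_homocyclicSTPPDesigns h)


end Summit.MatrixMultiplication.MatrixMultiplication.Theorems.HomocyclicSTPPDesigns.Universality
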